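import Mathlib
import HarnessLib
import Summits.ValiantsHypothesis.ValiantsHypothesis.Theorems.LacunarySymmetroidMatrixDescartesOsculationLawCuspCubicCountPrelim

/-!
# ValiantsHypothesis / LacunarySymmetroid — crux `MatrixDescartes` (stmt-ValiantsHypothesis-18050, V1),
# line «osculation-law»: the NON-MONIC cubic cusp curve `a₃b³ + a₂b² + a₁b + a₀ = 0` — counting tools

Rank-three column `(3, s)` of the line's law (val-lit-p5 g11's programme; this is the count half (β)): the letter
inserted into a symmetric pencil on `Fin 3 ⊕ Fin s` gives `Ψ(t,b) = a₃(t)b³ + a₂(t)b² + a₁(t)b + a₀(t)` with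
`a₃ = det G₂₂ ≢ 0` in general NOT a unit.  Tools generalising `…CuspCubicCountPrelim` (no definitions, no named
facts):

* `fibre_three_le_gen` — ≤ 3 ordinates over each abscissa at which `Ψ(t,·)` is not the zero polynomial;
* `disc_nonneg_of_factor_gen` — a quadratic factor of the real-rooted NON-MONIC cubic is real-rooted;
* `sign_of_pos_root`, `exists_pos_root_of_sign` — VIETA SIGNS: a positive root forces one of `a₂a₃, a₁a₃, a₀a₃` to
  be negative, and conversely (for a real-rooted cubic) a negative one of them forces a positive root — the root
  persistence of the count needs no eigenvectors and no continuity of roots (val-lit-p5 g11's remark (P1)).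

Honest framing: helper lemmas for a located column of an UNREGISTERED V1 law line; `OsculationLaw`, `PeelInequality`,
`MatrixDescartes`, Conjecture B and `VP ≠ VNP` are OPEN / NOT proved.
-/

-- `Summit.ValiantsHypothesis.ValiantsHypothesis.…` is the tree's mandated single-conjunct layout (Sub = Summit).
set_option linter.dupNamespace false

noncomputable section

namespace Summit.ValiantsHypothesis.ValiantsHypothesis.Theorems.LacunarySymmetroidMatrixDescartes

open Polynomial Set
open scoped BigOperators

namespace OsculationCuspCubic

/-! ### Fibres: at most three ordinates over a non-degenerate abscissa -/

/-- **Three ordinates per abscissa (non-monic).**  If every point `p` of `T` has `p 0 > 0` a root of the nonzero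
polynomial `P`, `p 1` a root of `Ψ(p 0, ·) = a₃b³ + a₂b² + a₁b + a₀`, and `Ψ(p 0, ·)` is not the zero polynomial,
then `#T ≤ 3·|supp P|`. [folklore] -/
theorem fibre_three_le_gen (a₃ a₂ a₁ a₀ P : ℝ[X]) (hP : P ≠ 0) (T : Set (Fin 2 → ℝ))
    (hT : ∀ p ∈ T, 0 < p 0 ∧ P.IsRoot (p 0) ∧
      a₃.eval (p 0) * p 1 ^ 3 + a₂.eval (p 0) * p 1 ^ 2 + a₁.eval (p 0) * p 1 + a₀.eval (p 0) = 0 ∧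
      ¬ (a₃.eval (p 0) = 0 ∧ a₂.eval (p 0) = 0 ∧ a₁.eval (p 0) = 0 ∧ a₀.eval (p 0) = 0)) :
    T.ncard ≤ 3 * P.support.card := by
  classical
  set TP : Finset ℝ := P.roots.toFinset.filter (fun t => 0 < t) with hTP
  set cub : ℝ → ℝ[X] := fun t =>
    C (a₃.eval t) * X ^ 3 + C (a₂.eval t) * X ^ 2 + C (a₁.eval t) * X + C (a₀.eval t) with hcub
  have hcub_deg : ∀ t, (cub t).natDegree ≤ 3 := fun t => by
    rw [hcub]; exact Polynomial.natDegree_cubic_le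
  set S : Finset (Fin 2 → ℝ) :=
    TP.biUnion (fun t => ((cub t).roots.toFinset).image (fun b => (![t, b] : Fin 2 → ℝ))) with hS
  have hsub : T ⊆ (S : Set (Fin 2 → ℝ)) := by
    intro p hp
    obtain ⟨htp, hroot, hΨp, hnd⟩ := hT p hp
    have hcub_ne : cub (p 0) ≠ 0 := by
      intro h0
      apply hnd
      have hc : ∀ n, (cub (p 0)).coeff n = 0 := fun n => by rw [h0, coeff_zero]
      have h3 := hc 3
      have h2 := hc 2
      have h1 := hc 1
      have h00 := hc 0
      simp only [hcub, coeff_add, coeff_C_mul, coeff_X_pow, coeff_X, coeff_C] at h3 h2 h1 h00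
      norm_num at h3 h2 h1 h00
      exact ⟨h3, h2, h1, h00⟩
    rw [Finset.mem_coe, hS, Finset.mem_biUnion]
    refine ⟨p 0, ?_, ?_⟩
    · rw [hTP, Finset.mem_filter, Multiset.mem_toFinset, mem_roots hP]
      exact ⟨hroot, htp⟩
    · rw [Finset.mem_image]
      refine ⟨p 1, ?_, ?_⟩
      · rw [Multiset.mem_toFinset, mem_roots hcub_ne, hcub, IsRoot.def]
        simp only [eval_add, eval_mul, eval_C, eval_pow, eval_X]
        linarith
      · funext i
        fin_cases i <;> rfl
  calc T.ncard ≤ (S : Set (Fin 2 → ℝ)).ncard := Set.ncard_le_ncard hsub (Finset.finite_toSet _)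
    _ = S.card := Set.ncard_coe_finset _
    _ ≤ ∑ t ∈ TP, (((cub t).roots.toFinset).image (fun b => (![t, b] : Fin 2 → ℝ))).card :=
        Finset.card_biUnion_le
    _ ≤ ∑ t ∈ TP, 3 := by
        refine Finset.sum_le_sum fun t _ => ?_
        calc _ ≤ ((cub t).roots.toFinset).card := Finset.card_image_le
          _ ≤ Multiset.card (cub t).roots := Multiset.toFinset_card_le _
          _ ≤ (cub t).natDegree := Polynomial.card_roots' _
          _ ≤ 3 := hcub_deg t
    _ = 3 * TP.card := by rw [Finset.sum_const, smul_eq_mul, mul_comm]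
    _ ≤ 3 * P.support.card := by
        apply Nat.mul_le_mul_left
        calc TP.card = (P.roots.filter (fun t => 0 < t)).toFinset.card := by
              rw [hTP, Multiset.toFinset_filter]
          _ ≤ Multiset.card (P.roots.filter (fun t => 0 < t)) := Multiset.toFinset_card_le _
          _ ≤ P.support.card := OsculationRankOne.card_roots_filter_pos_le_card_support P

/-! ### A quadratic factor of a real-rooted non-monic cubic is real-rooted -/

/-- Non-monic form of `disc_nonneg_of_factor`: if `Ψ(b) = a₃·(b − μ₁)(b − μ₂)(b − μ₃)` with `a₃ ≠ 0` and
`r₂²·Ψ(b) = (a₃ r₂ b + c)·(r₂b² + r₁b + r₀)` for all `b` with `r₂ ≠ 0`, then `r₁² − 4 r₂ r₀ ≥ 0`. [folklore] -/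
theorem disc_nonneg_of_factor_gen {a₃ a₂ a₁ a₀ r₂ r₁ r₀ c : ℝ} (ha₃ : a₃ ≠ 0) (hr₂ : r₂ ≠ 0)
    (hreal : ∃ μ₁ μ₂ μ₃ : ℝ, ∀ b : ℝ,
      a₃ * b ^ 3 + a₂ * b ^ 2 + a₁ * b + a₀ = a₃ * ((b - μ₁) * (b - μ₂) * (b - μ₃)))
    (hid : ∀ b : ℝ, r₂ ^ 2 * (a₃ * b ^ 3 + a₂ * b ^ 2 + a₁ * b + a₀) =
      (a₃ * r₂ * b + c) * (r₂ * b ^ 2 + r₁ * b + r₀)) :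
    0 ≤ r₁ ^ 2 - 4 * r₂ * r₀ := by
  obtain ⟨μ₁, μ₂, μ₃, hμ⟩ := hreal
  have key : ∀ μ : ℝ, r₂ * μ ^ 2 + r₁ * μ + r₀ = 0 → 0 ≤ r₁ ^ 2 - 4 * r₂ * r₀ := by
    intro μ hq
    have : r₁ ^ 2 - 4 * r₂ * r₀ = (2 * r₂ * μ + r₁) ^ 2 := by linear_combination (-4) * r₂ * hq
    rw [this]; exact sq_nonneg _
  have hev : ∀ μ : ℝ, (μ - μ₁) * (μ - μ₂) * (μ - μ₃) = 0 →
      (a₃ * r₂ * μ + c) * (r₂ * μ ^ 2 + r₁ * μ + r₀) = 0 := by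
    intro μ h0
    rw [← hid μ, hμ μ, h0, mul_zero, mul_zero]
  have h1 := hev μ₁ (by ring)
  have h2 := hev μ₂ (by ring)
  have h3 := hev μ₃ (by ring)
  have har : a₃ * r₂ ≠ 0 := mul_ne_zero ha₃ hr₂
  rcases mul_eq_zero.1 h1 with h1a | h1b
  · rcases mul_eq_zero.1 h2 with h2a | h2b
    · rcases mul_eq_zero.1 h3 with h3a | h3b
      · -- all three roots coincide
        have e2 : μ₂ = μ₁ := by
          have : a₃ * r₂ * (μ₂ - μ₁) = 0 := by linarith
          rcases mul_eq_zero.1 this with h | h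
          · exact absurd h har
          · linarith
        have e3 : μ₃ = μ₁ := by
          have : a₃ * r₂ * (μ₃ - μ₁) = 0 := by linarith
          rcases mul_eq_zero.1 this with h | h
          · exact absurd h har
          · linarith
        have hc : c = -(a₃ * r₂ * μ₁) := by linarith
        have hp := hid (μ₁ + 1)
        have hm := hid (μ₁ - 1)
        rw [hμ, e2, e3, hc] at hp hm
        have hp' : (a₃ * r₂) * (r₂ * (μ₁ + 1) ^ 2 + r₁ * (μ₁ + 1) + r₀) = (a₃ * r₂) * r₂ := by nlinarith [hp]
        have hm' : (a₃ * r₂) * (r₂ * (μ₁ - 1) ^ 2 + r₁ * (μ₁ - 1) + r₀) = (a₃ * r₂) * r₂ := by nlinarith [hm]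
        have hp'' : r₂ * (μ₁ + 1) ^ 2 + r₁ * (μ₁ + 1) + r₀ = r₂ := mul_left_cancel₀ har hp'
        have hm'' : r₂ * (μ₁ - 1) ^ 2 + r₁ * (μ₁ - 1) + r₀ = r₂ := mul_left_cancel₀ har hm'
        exact key μ₁ (by nlinarith [hp'', hm''])
      · exact key μ₃ h3b
    · exact key μ₂ h2b
  · exact key μ₁ h1b

/-! ### Vieta signs -/

/-- **A positive root forces a sign.**  If `a₃ ≠ 0` and `a₃b₀³ + a₂b₀² + a₁b₀ + a₀ = 0` with `b₀ > 0`, then one of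
`a₂a₃, a₁a₃, a₀a₃` is negative. [folklore] -/
theorem sign_of_pos_root {a₃ a₂ a₁ a₀ b₀ : ℝ} (ha₃ : a₃ ≠ 0) (hb₀ : 0 < b₀)
    (hroot : a₃ * b₀ ^ 3 + a₂ * b₀ ^ 2 + a₁ * b₀ + a₀ = 0) :
    a₂ * a₃ < 0 ∨ a₁ * a₃ < 0 ∨ a₀ * a₃ < 0 := by
  by_contra h
  push Not at h
  obtain ⟨h2, h1, h0⟩ := h
  have hsq : 0 < a₃ * a₃ := mul_self_pos.2 ha₃
  have hb3 : 0 < b₀ ^ 3 := pow_pos hb₀ 3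
  have : a₃ * (a₃ * b₀ ^ 3 + a₂ * b₀ ^ 2 + a₁ * b₀ + a₀) = 0 := by rw [hroot, mul_zero]
  nlinarith [mul_nonneg h2 (sq_nonneg b₀), mul_nonneg h1 hb₀.le, mul_pos hsq hb3]

/-- **A sign forces a positive root** (real-rooted cubic): if `Ψ(b) = a₃(b − μ₁)(b − μ₂)(b − μ₃)` with `a₃ ≠ 0` and
one of `a₂a₃, a₁a₃, a₀a₃` is negative, then `Ψ` has a positive root (one of the `μᵢ`).  Contrapositive of Vieta:
roots `≤ 0` give `a₂/a₃ = −Σμᵢ ≥ 0`, `a₁/a₃ = Σμᵢμⱼ ≥ 0`, `a₀/a₃ = −μ₁μ₂μ₃ ≥ 0`. [folklore] -/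
theorem exists_pos_root_of_sign {a₃ a₂ a₁ a₀ : ℝ} (ha₃ : a₃ ≠ 0)
    (hreal : ∃ μ₁ μ₂ μ₃ : ℝ, ∀ b : ℝ,
      a₃ * b ^ 3 + a₂ * b ^ 2 + a₁ * b + a₀ = a₃ * ((b - μ₁) * (b - μ₂) * (b - μ₃)))
    (hsign : a₂ * a₃ < 0 ∨ a₁ * a₃ < 0 ∨ a₀ * a₃ < 0) :
    ∃ b : ℝ, 0 < b ∧ a₃ * b ^ 3 + a₂ * b ^ 2 + a₁ * b + a₀ = 0 := by
  obtain ⟨μ₁, μ₂, μ₃, hμ⟩ := hreal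
  -- Vieta through three evaluations
  have e0 := hμ 0
  have e1 := hμ 1
  have e2 := hμ (-1)
  have v2 : a₂ = -a₃ * (μ₁ + μ₂ + μ₃) := by linear_combination (1 / 2) * e1 + (1 / 2) * e2 - e0
  have v1 : a₁ = a₃ * (μ₁ * μ₂ + μ₁ * μ₃ + μ₂ * μ₃) := by linear_combination (1 / 2) * e1 - (1 / 2) * e2
  have v0 : a₀ = -a₃ * (μ₁ * μ₂ * μ₃) := by linear_combination e0
  have hsq : 0 < a₃ * a₃ := mul_self_pos.2 ha₃
  by_cases h1 : 0 < μ₁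
  · exact ⟨μ₁, h1, by rw [hμ]; ring⟩
  by_cases h2 : 0 < μ₂
  · exact ⟨μ₂, h2, by rw [hμ]; ring⟩
  by_cases h3 : 0 < μ₃
  · exact ⟨μ₃, h3, by rw [hμ]; ring⟩
  push Not at h1 h2 h3
  exfalso
  have s1 : 0 ≤ a₂ * a₃ := by
    rw [v2]; nlinarith
  have s2 : 0 ≤ a₁ * a₃ := by
    rw [v1]; nlinarith [mul_nonneg_of_nonpos_of_nonpos h1 h2, mul_nonneg_of_nonpos_of_nonpos h1 h3,
      mul_nonneg_of_nonpos_of_nonpos h2 h3]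
  have s3 : 0 ≤ a₀ * a₃ := by
    rw [v0]
    have : μ₁ * μ₂ * μ₃ ≤ 0 := mul_nonpos_of_nonneg_of_nonpos (mul_nonneg_of_nonpos_of_nonpos h1 h2) h3
    nlinarith
  rcases hsign with h | h | h <;> linarith

end OsculationCuspCubic

end Summit.ValiantsHypothesis.ValiantsHypothesis.Theorems.LacunarySymmetroidMatrixDescartes
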